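import Summits.QuantumFields.YangMills.Theorems.BalabanUVNodesN11Sect3SupplyChainNode
import Summits.QuantumFields.YangMills.Theorems.BalabanUVNodesK1EndOfNodes13PWSOfRunRemAt
import Summits.QuantumFields.YangMills.Theorems.StabilityBAtRecordR13SepCoPH.Negative.SignBoxAtEveryWitnessFalse

/-!
# DAG node N11 × K1⁷ — THE CEILING LETTER IS FREE ON N11's WITNESS-CHAIN ROAD: the thirteen DAG nodes, p602267's rung-1 datum `Rung1At` and dag-n24-w1's two
# run-letter closing faces of p598782 pass to EVERY ceiling `withCeiling w c` — so their match hypothesis `hmatch : … ≤ w.βup` (v6's MATCHʳ, CRIT-1's `N11CU`) DISAPPEARS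

HEADER — WORK-UNIT METADATA.  Cell `pub-ymgap`, YM-PLAN Track A (HUMAN RULING D-0062), seat `pub-ymgap-dag-n11-d` (g14; R134 fan-out base seat N11 [B14], strategy s2),
route `BalabanUVNodes` rev 25 (v1.7 `CoPH` key), item K1⁷ `StabilityBAtRecordR13SepCoPH` = stmt-QuantumFields-20542 (helper lane, `--kind proof --supports 20542 --as helper`,
count-neutral).  [III] = [Balaban1988Convergent], [V] = [Balaban1989LargeFieldII], [I] = [Balaban1987RG1].  Over dag-n11-e's `…Sect3SupplyChainObligationsDefs` ∕ `…Sect3SupplyChainNode`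
(p595576 ∕ p596032: the one-token residual `SupplyChainAt θ P` of N11 on the witness-chain road and the node face `b14_main_of_obligations` — which reads of the world `w` ONLY the
binding `w.C = datum.C`, as their p606248 l.27 says), dag-n24-w1's `…K1EndOfNodes13PWSOfRunRemAt` (p598782: the K1⁷ consequent AT θ from a rung-1 datum and run letters, with the ONE
K1-side letter `hmatch : … ≤ w.βup`) and `…K1BetaWindow13SOfNodes13PWSOfBoxH` (`nodes_leavesP_reletter_ceiling_of_le`: the DOWNWARD ceiling re-lettering, «UPWARD is NOT available»), and
the ym-nodeO negative lemma p602267 `…Negative.SignBoxAtEveryWitnessFalse` (`withCeiling`, `Rung1At`, `rung1At_lowerβup`).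

WHY THIS FILE.  K1 skeleton v6's `stub_runRows13PWS` must return a nodes-world `w′` whose ceiling letter matches the run rows, `B + r ≤ w′.βup` (plan README's MATCHʳ); the input
nodes-world carries no ceiling information, and of the thirteen DAG mains exactly ONE reads `w.βup` — N11 = `Dag.B14_main`, through its HYPOTHESIS `(smallCouplings → flowControl)`
((2.6) [III] at `β′ = w.βup`) — so the nodes re-letter the ceiling DOWNWARD only and every proof of stub 2″ contains «N11 at a raised ceiling» (ym-nodeO CRIT-1 g4 on idea
`k1-ceiling-before-world` ed.2: the named piece `N11CU`).  THIS FILE types the N11 half of that observation against the tree's ONLY N11 road, the witness chain: N11's node at a world is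
supplied from `SupplyChainAt θ P` — a (θ, P)-keyed, WORLD-FREE token ([III] §3's obligations along the supplier's own chain + the no-expansion obligation) — by dag-n11-e's
`b14_main_of_obligations`, which never reads `w.βup` (the node's proof discards the `flowControl` antecedent: (2.6) enters N11's faces only through the WINDOW and θ's numerics).  Hence,
GIVEN the chain at θ: §1 the UPWARD re-lettering of the thirteen nodes costs exactly N11 at the new ceiling (generic; CRIT-1's sketch lemma `nodes_reletter`, tree edition) and is
therefore FREE (`nodes_leavesP_withCeiling_of_supplyChainAt`, every `c`); §2 p602267's rung-1 datum `Rung1At F θ h w` passes to `withCeiling w c` for every `c` (the UPWARD twin of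
`rung1At_lowerβup`); §3 p598782's two closing faces hold WITHOUT `hmatch` — apply them at `withCeiling w (B + r)` (resp. `withCeiling w (2c·stepBal + 2|c|A)`), `le_rfl`.  Net: on the
chain road `N11CU` is free relative to N11, and stub 2″'s conjunct (iii) asks nothing of the β cell beyond the run rows themselves.  (`N11CU`, `Stub2WF` and the v6 texts live outside
`lean/` and are neither imported nor restated; the plan's ∕ the K1 lead's word decides what to do with this.)

WHAT THIS FILE PROVES (0 `def`, 0 `sorry`, standard axioms; composition BY NAME).
§1 `nodes_leavesP_withCeiling_of_b14_main` (generic `WorldP`, any `N`: nodes at `w` + N11 at `withCeiling w c` ⇒ nodes at `withCeiling w c`; the twelve other mains are `βup`-free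
   by `rfl`, pattern of `nodes_leavesP_reletter_ceiling_of_le`) · ★ `b14_main_leavesP_of_supplyChainAt_of_window` (N11's node at ANY world bound to the CoPH datum of `θ`, the chain
   asked ONLY on runs inside the world's own window — threaded through the node's `smallCouplings` antecedent; cf. `b14_main_of_obligations`, which asks the chain outright) · ★★
   `nodes_leavesP_withCeiling_of_supplyChainAt` (nodes at `w` ⇒ nodes at EVERY `withCeiling w c`).
§2 ★★ `rung1At_withCeiling_of_supplyChainAt` (`N = 2`: `Rung1At F θ h w` ⇒ `Rung1At F θ h (withCeiling w c)` for every `c`, given the chain at θ on the runs of the world's window,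
   the live-selector clause, the three term-constant signs and `1 ≤ M`).
§3 ★★★ `stabilityB_body_of_rung1At_of_runLetters_of_supplyChainAt` (= p598782 §2 ★ `stabilityB_body_of_rung1At_of_runLetters` with `hmatch : B + r ≤ w.βup` DELETED) · ★★★
   `stabilityB_body_of_rung1At_of_runRemAt_of_drift_of_supplyChainAt` (= p598782 §3 ★★ with `hmatch : 2c·stepBal + 2|c|A ≤ w.βup` DELETED: a rung-1 datum, K2⁷'s run letter
   `RunRemAt F κ θ h c`, the bare drift and N11's chain at θ ⊢ the crux's consequent at θ).
§4 ★★★ `stabilityBAtRecordR13SepCoPH_of_rung1WithChain_of_runRemAt` — the ROUTE DECL BY NAME (type literally `…Theses.BalabanUVNodes.StabilityBAtRecordR13SepCoPH`) from ONE ∃-side producer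
   «rung 1 with N11's chain at the witness + the run rows + the bare drift» (p598782 §4's producer with its match conjunct replaced by the chain); CONDITIONAL, K1⁷ NOT closed.

HONEST FRAMING.  Helper lane of K1⁷; count-neutral kernel composition of landed theorems; nothing of Bałaban asserted.  `SupplyChainAt θ P` (i.e. `SupplierObligations` = [III] §3 ∕ Thm 2
and the no-expansion obligation), the rung-1 datum, the run letters and the drift are HYPOTHESES, inhabited at no θ here; N11 NOT discharged; K1⁷ NOT closed — v6's registered stubs
`stub_nodes13PWS ∕ stub_runRows13PWS` are untouched and no stub is closed; counts unmoved (typed 28∕28 · discharged 5∕27).  One finite `𝕋⁴_{L^K}` programme at fixed `ε = L^{−K}`;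
R4 closes only the conditional finite-𝕋⁴ rung `BalabanLadder.UV` — NOT ℝ⁴, NOT OS, NOT a mass gap, NOT Clay.  No `sorry`, `axiom`, `def`, `instance`, `notation`.
Sources (SHAPE ∕ bookkeeping only): [III] Thm 1 p.262, Theorem p.245, (2.6) p.255 («β′ … can be chosen … if γ is sufficiently small»), Cor. 3 (2.50) p.264, p.244 L36–38; [V] Thm 1 +
(0.1) pp.355–356; [I] (0.20) p.256, Thm 2 p.259, (1.20)–(1.22) p.264, Thm 3 p.264, (2.12)–(2.14) p.268.
-/

noncomputable section

open scoped Matrix.Norms.L2Operator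

namespace Summit.QuantumFields.YangMills.Theorems.BalabanUVNodesN11K1CeilingFreeOfSupplyChain

open Literature.MathematicalPhysics.QuantumFieldTheory.Balaban1983to89
open Literature.MathematicalPhysics.QuantumFieldTheory.Balaban1983to89.Node00
open DagBinding T4Continuum T4DatumAssembly FlowStepRuns
open FlowStep (RGEqH prefixOf)
open Literature.MathematicalPhysics.QuantumFieldTheory.Balaban1983to89.Beta.Drift (OneLoopDrift)
open Literature.MathematicalPhysics.QuantumFieldTheory.Balaban1983to89.B16RLeafRecord13LiveCoPH (b14_main_at_record₁₃CoPH_of_rOpLeaf rOpLeaf_VOfRecord₁₃CoPH_of_liveSel_of_rstep)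
open Summit.QuantumFields.YangMills.Theorems.BalabanUVNodesK2JsOfRecord (StepColourData beta0OfJs)
open Summit.QuantumFields.YangMills.Theorems.BalabanUVNodesK2NamedJetsRunRemAt (RunRemAt RunConstRemainder)
open Summit.QuantumFields.YangMills.BalabanUVNodes.K1EndOfNodes13PWSOfRunRemAt (stabilityB_body_of_rung1At_of_runLetters stabilityB_body_of_rung1At_of_runRemAt_of_drift)
open Summit.QuantumFields.YangMills.Theorems.StabilityBAtRecordR13SepCoPH.Negative.SignBoxAtEveryWitnessFalse (withCeiling Rung1At)
open BalabanUVNodesN11Sect3SupplyChainObligationsDefs (SupplyChainAt thmP245Laws_of_supplyChainAt)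
open BalabanUVNodesN11Sect3SupplyChainNode (b14_main_of_obligations)

variable {F : T4Family} {N : ℕ} [NeZero N]

/-! ## §1  The UPWARD ceiling re-lettering of the thirteen nodes costs exactly N11 — and N11 on the chain road does not read the ceiling -/

section Nodes

/-- **THE UPWARD CEILING RE-LETTERING OF THE THIRTEEN DAG NODES COSTS EXACTLY N11 AT THE NEW CEILING** (generic; ym-nodeO CRIT-1's sketch lemma `nodes_reletter`, ceiling part, tree
edition): of the 22 leaves of `leavesP w P` only `running`, `betaSmoothBounded` and `flowControl` read `w.βup`, and of the thirteen mains only N11 = `Dag.B14_main` reads one of them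
(`flowControl`, as a hypothesis) — the other twelve node statements at `withCeiling w c` are those at `w` by `rfl`.  (Pattern of dag-n24-w1's `nodes_leavesP_reletter_ceiling_of_le`,
whose DOWNWARD direction needs no N11 input.) [cite: Balaban1989LargeFieldII, Introduction pp.355–356 (the citation DAG); Balaban1988Convergent, Thm 1 p.262 and (2.6) p.255 (where `β⁺` enters; bookkeeping)] -/
theorem nodes_leavesP_withCeiling_of_b14_main (w : WorldP) (c : ℝ) (P : B12.RunParams) (hn : Nodes (leavesP w P))
    (h14 : Dag.B14_main (leavesP (withCeiling w c) P)) : Nodes (leavesP (withCeiling w c) P) := by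
  obtain ⟨h4, h5, h6, h7, h8, h9, h10, h11, h12, h13, -, h15, h16⟩ := hn
  exact ⟨h4, h5, h6, h7, h8, h9, h10, h11, h12, h13, h14, h15, h16⟩

variable {θ : Stage13HParams F N} {p : B12.RunParams}

/-- **★ N11's NODE AT ANY WORLD BOUND TO THE CoPH DATUM OF `θ`, THE CHAIN ASKED ONLY ON RUNS INSIDE THE WORLD's OWN WINDOW** (`βup`, `β₀`, `b`, `L`, `up` UNREAD): dag-n11-e's
`b14_main_of_obligations` threaded through the node's own `smallCouplings` antecedent — if the run `p` lies in the window `]0, w.γ]` of the world, N11's one-token residual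
`SupplyChainAt θ p` on the live-selector line gives the (S1ᵀ) slot (`thmP245Laws_of_supplyChainAt`); the 𝐑-antecedent is read through the leaf (`rOpLeaf_VOfRecord₁₃CoPH_of_liveSel_of_rstep`).
[cite: Balaban1988Convergent, Thm 1 p.262, Theorem p.245, p.244 L36–38, (2.6) p.255; Balaban1989LargeFieldI, (0.3) p.176, p.177 (i)–(ii)] -/
theorem b14_main_leavesP_of_supplyChainAt_of_window (h : θ.Provisos₁₃CoPH F N)
    (hsel : θ.ppSel = ppSelLiveOfRecord F N θ.ν θ.τ9 (EOfRecord₁₃ F N θ.toStage13Params) (wOfRecord₉ F N θ.toStage9Params))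
    (hθ : θ.Admissible F N) (hκ : 0 ≤ θ.s2.lf.κ) (hE₀ : 0 ≤ θ.s2.lf.E₀) (hB₀ : 0 ≤ θ.s2.lf.B₀) (hM : 1 ≤ θ.τ9.M)
    (w : WorldP) (hC : w.C = (datumOfRecord₁₃CoPH F N θ h).C)
    (hN : ((datumOfRecord₁₃CoPH F N θ h).C p).flow.InInterval w.γ p.K → SupplyChainAt θ p) :
    Dag.B14_main (leavesP w p) :=
  b14_main_at_record₁₃CoPH_of_rOpLeaf F N θ p w h hC
    (fun _ => rOpLeaf_VOfRecord₁₃CoPH_of_liveSel_of_rstep F N θ p (fun q j _ hj => h.rstep q j hj) hθ hκ hE₀ hB₀ hsel)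
    (fun _ _ _ _ _ hsc _ _ => thmP245Laws_of_supplyChainAt h hsel hθ hκ hE₀ hB₀ hM (hN (by
      have hsc' : (w.C p).flow.InInterval w.γ p.K := hsc
      rwa [hC] at hsc')))

/-- **★★ THE THIRTEEN NODES PASS TO EVERY CEILING, GIVEN N11's CHAIN AT θ**: nodes at a world `w` bound to the CoPH datum of `θ` + `SupplyChainAt θ p` on the runs of the world's window
⇒ nodes at `withCeiling w c`, for EVERY real `c` (upward included).  [cite: Balaban1989LargeFieldII, Introduction pp.355–356; Balaban1988Convergent, Thm 1 p.262, (2.6) p.255 (bookkeeping)] -/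
theorem nodes_leavesP_withCeiling_of_supplyChainAt (h : θ.Provisos₁₃CoPH F N)
    (hsel : θ.ppSel = ppSelLiveOfRecord F N θ.ν θ.τ9 (EOfRecord₁₃ F N θ.toStage13Params) (wOfRecord₉ F N θ.toStage9Params))
    (hθ : θ.Admissible F N) (hκ : 0 ≤ θ.s2.lf.κ) (hE₀ : 0 ≤ θ.s2.lf.E₀) (hB₀ : 0 ≤ θ.s2.lf.B₀) (hM : 1 ≤ θ.τ9.M)
    (w : WorldP) (hC : w.C = (datumOfRecord₁₃CoPH F N θ h).C)
    (hN : ((datumOfRecord₁₃CoPH F N θ h).C p).flow.InInterval w.γ p.K → SupplyChainAt θ p)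
    (hn : Nodes (leavesP w p)) (c : ℝ) : Nodes (leavesP (withCeiling w c) p) :=
  nodes_leavesP_withCeiling_of_b14_main w c p hn
    (b14_main_leavesP_of_supplyChainAt_of_window h hsel hθ hκ hE₀ hB₀ hM (withCeiling w c) hC hN)

end Nodes

/-! ## §2  p602267's rung-1 datum passes to every ceiling (the UPWARD twin of `rung1At_lowerβup`) -/

section Rung

variable {θ : Stage13HParams F 2} {h : θ.Provisos₁₃SepCoPH F 2} {w : WorldP}

variable (F) in
/-- **★★ THE RUNG-1 DATUM AT EVERY CEILING, GIVEN N11's CHAIN AT θ**: `Rung1At F θ h w` (unity ∧ slots, admissibility, the S-record binding of `w`, the thirteen nodes at every run,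
`PrintedUV3V`, the [IV]-pin — none but the nodes reads `βup`, and `withCeiling` keeps `C`, `γ`, `L`, `up`) ⇒ `Rung1At F θ h (withCeiling w c)` for EVERY `c`, from `SupplyChainAt θ P` on
the runs of the world's window, the live-selector clause, the three term-constant signs and `1 ≤ M` (§1).  p602267's `rung1At_lowerβup` is the downward half, which needs no chain.
[cite: Balaban1989LargeFieldII, Thm 1 + (0.1) pp.355–356; Balaban1988Convergent, Thm 1 p.262, (2.6) p.255 (bookkeeping)] -/
theorem rung1At_withCeiling_of_supplyChainAt (hr : Rung1At F θ h w)
    (hsel : θ.ppSel = ppSelLiveOfRecord F 2 θ.ν θ.τ9 (EOfRecord₁₃ F 2 θ.toStage13Params) (wOfRecord₉ F 2 θ.toStage9Params))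
    (hκ : 0 ≤ θ.s2.lf.κ) (hE₀ : 0 ≤ θ.s2.lf.E₀) (hB₀ : 0 ≤ θ.s2.lf.B₀) (hM : 1 ≤ θ.τ9.M)
    (hN : ∀ P : B12.RunParams, ((datumOfRecord₁₃SepCoPH F 2 θ h).C P).flow.InInterval w.γ P.K → SupplyChainAt θ P) (c : ℝ) :
    Rung1At F θ h (withCeiling w c) := by
  obtain ⟨hU, hθ, hR, hnodes, h08, lam, hlam, hpin⟩ := hr
  obtain ⟨θ', h', hθ', hD, hC, hγ, hL, hup⟩ := hR
  exact ⟨hU, hθ, ⟨θ', h', hθ', hD, hC, hγ, hL, hup⟩,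
    fun P => nodes_leavesP_withCeiling_of_supplyChainAt h.toCore hsel hθ hκ hE₀ hB₀ hM w hC (hN P) (hnodes P) c, h08, lam, hlam, fun P hP => hpin P hP⟩

end Rung

/-! ## §3  dag-n24-w1's two run-letter closing faces of p598782 WITHOUT the match hypothesis -/

section RunLetters

variable {F : T4Family}

/-- **★★★ THE CRUX's CONSEQUENT AT θ FROM A RUNG-1 DATUM AND RUN LETTERS — NO CEILING MATCH** (= p598782 §2 ★ `stabilityB_body_of_rung1At_of_runLetters` with `hmatch : B + r ≤ w.βup`
DELETED), given N11's chain at θ on the runs of the world's window: the rung-1 datum passes to `withCeiling w (B + r)` (§2) and there the match is `le_rfl`.  CONDITIONAL (the chain, the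
datum, the run letters are hypotheses); closes nothing. [cite: Balaban1989LargeFieldII, Thm 1 p.355 + (0.1) pp.355–356 + p.391; Balaban1988Convergent, (2.6) p.255, Cor. 3 (2.50) p.264; Balaban1987RG1, (0.20) p.256, Thm 2 p.259, Thm 3 p.264 (bookkeeping)] -/
theorem stabilityB_body_of_rung1At_of_runLetters_of_supplyChainAt (θ : Stage13HParams F 2) (h : θ.Provisos₁₃SepCoPH F 2) (w : WorldP) (hr : Rung1At F θ h w)
    (hsel : θ.ppSel = ppSelLiveOfRecord F 2 θ.ν θ.τ9 (EOfRecord₁₃ F 2 θ.toStage13Params) (wOfRecord₉ F 2 θ.toStage9Params))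
    (hκ : 0 ≤ θ.s2.lf.κ) (hE₀ : 0 ≤ θ.s2.lf.E₀) (hB₀ : 0 ≤ θ.s2.lf.B₀) (hM : 1 ≤ θ.τ9.M)
    (hN : ∀ P : B12.RunParams, ((datumOfRecord₁₃SepCoPH F 2 θ h).C P).flow.InInterval w.γ P.K → SupplyChainAt θ P)
    {b : ℕ → ℝ} {r γ₀ B M : ℝ} (hγ₀ : 0 < γ₀) (hrem : RunConstRemainder (betaOfRecord₁₃ F 2 θ.toStage13Params) b r γ₀) (hB : ∀ k, b k ≤ B)
    (hps : ∀ (n : ℕ) (gs : ℕ → ℝ), RGEqH n (betaOfRecord₁₃ F 2 θ.toStage13Params) gs → Step.InInterval γ₀ n gs →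
      ∀ k, k ≤ n → -M ≤ ∑ j ∈ Finset.Ico k n, betaOfRecord₁₃ F 2 θ.toStage13Params j (prefixOf gs j)) :
    (θ.ZhUnity F 2 ∧ θ.SlotsNondegenerate₁₃ F 2) ∧ θ.Admissible F 2 ∧ B16.EndStatementBPrinted (datumOfRecord₁₃SepCoPH F 2 θ h).C ∧
      ∃ γ₁ : ℝ, 0 < γ₁ ∧ ∀ γ : ℝ, 0 < γ → γ ≤ γ₁ → ∃ P : B12.RunParams, 1 ≤ P.K ∧ ((datumOfRecord₁₃SepCoPH F 2 θ h).C P).flow.InInterval γ P.K := by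
  obtain ⟨hU, hθ, hR, hnodes, -, -⟩ := rung1At_withCeiling_of_supplyChainAt F hr hsel hκ hE₀ hB₀ hM hN (B + r)
  exact stabilityB_body_of_rung1At_of_runLetters θ h (withCeiling w (B + r)) hU hθ hR hnodes hγ₀ hrem hB le_rfl hps

/-- **★★★ THE CRUX's CONSEQUENT AT θ FROM A RUNG-1 DATUM, K2⁷'s RUN LETTER AND THE BARE DRIFT — NO CEILING MATCH** (= p598782 §3 ★★ `stabilityB_body_of_rung1At_of_runRemAt_of_drift` with
`hmatch : 2c·stepBal 2 F.L + 2|c|A ≤ w.βup` DELETED), given N11's chain at θ on the runs of the world's window (apply the face at `withCeiling w (2c·stepBal + 2|c|A)`).  On the chain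
road the β cell's K1 bill is EXACTLY K2⁷'s currency `RunRemAt F κ θ h c` + the bare drift, with no number crossing to the nodes cell.  CONDITIONAL; closes nothing; (P6) unpinned.
[cite: Balaban1987RG1, Thm 2 p.259, Thm 3 p.264, (1.20)–(1.22) p.264, (2.12)–(2.14) p.268; Balaban1989LargeFieldII, Thm 1 p.355; Balaban1988Convergent, (2.6) p.255 (bookkeeping)] -/
theorem stabilityB_body_of_rung1At_of_runRemAt_of_drift_of_supplyChainAt (θ : Stage13HParams F 2) (h : θ.Provisos₁₃SepCoPH F 2) (w : WorldP) (hr : Rung1At F θ h w)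
    (hsel : θ.ppSel = ppSelLiveOfRecord F 2 θ.ν θ.τ9 (EOfRecord₁₃ F 2 θ.toStage13Params) (wOfRecord₉ F 2 θ.toStage9Params))
    (hκ : 0 ≤ θ.s2.lf.κ) (hE₀ : 0 ≤ θ.s2.lf.E₀) (hB₀ : 0 ≤ θ.s2.lf.B₀) (hM : 1 ≤ θ.τ9.M)
    (hN : ∀ P : B12.RunParams, ((datumOfRecord₁₃SepCoPH F 2 θ h).C P).flow.InInterval w.γ P.K → SupplyChainAt θ P)
    (κ : StepColourData) {c A : ℝ} (hRun : RunRemAt F κ θ h c) (hdrift : OneLoopDrift (B12Normalization.stepBal 2 F.L) A (beta0OfJs F κ)) :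
    (θ.ZhUnity F 2 ∧ θ.SlotsNondegenerate₁₃ F 2) ∧ θ.Admissible F 2 ∧ B16.EndStatementBPrinted (datumOfRecord₁₃SepCoPH F 2 θ h).C ∧
      ∃ γ₁ : ℝ, 0 < γ₁ ∧ ∀ γ : ℝ, 0 < γ → γ ≤ γ₁ → ∃ P : B12.RunParams, 1 ≤ P.K ∧ ((datumOfRecord₁₃SepCoPH F 2 θ h).C P).flow.InInterval γ P.K := by
  obtain ⟨hU, hθ, hR, hnodes, -, -⟩ :=
    rung1At_withCeiling_of_supplyChainAt F hr hsel hκ hE₀ hB₀ hM hN (2 * (c * B12Normalization.stepBal 2 F.L) + 2 * (|c| * A))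
  exact stabilityB_body_of_rung1At_of_runRemAt_of_drift θ h (withCeiling w (2 * (c * B12Normalization.stepBal 2 F.L) + 2 * (|c| * A))) hU hθ hR hnodes κ hRun hdrift le_rfl

end RunLetters

/-! ## §4  The route decl BY NAME from ONE ∃-side producer «rung 1 WITH N11's chain at the witness + K2⁷'s run letter + the bare drift» — no ceiling letter anywhere -/

section Registered

/-- **★★★ K1⁷ BY NAME FROM «RUNG 1 WITH THE CHAIN AND THE RUN ROWS AT THE WITNESS» — NO MATCH** (p598782 §4 `stabilityBAtRecordR13SepCoPH_of_rung1WithRunRowsAt` with the conjunct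
`2c·stepBal 2 F.L + 2|c|A ≤ w.βup` REPLACED by N11's chain at θ on the runs of the witness world's window, plus the live-selector clause, the three signs and `1 ≤ M`).  `h` says: for every
family `F` with a unity Stage-13 tuple (K0⁷'s conclusion), SOME rung-1 datum `(θ, h, w)` (p602267's `Rung1At`: unity ∧ slots, admissibility, an S-bound world of the datum with the thirteen
nodes at every run, `PrintedUV3V`, the [IV]-pin) whose N11 comes by the witness chain (`SupplyChainAt θ P` on the window's runs — the tree's only N11 road) and which carries, at SOME scale
`c` and colour datum `κ`, the run rows `RunRemAt F κ θ h c` with the bare drift (defect `A`).  Conclusion: `Summit.QuantumFields.YangMills.Theses.BalabanUVNodes.StabilityBAtRecordR13SepCoPH`,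
the TYPE literally.  So on the chain road K1⁷ = «rung 1 + N11's chain + the run rows, ALL at the K0 witness» with NO numeric match between the β cell and the nodes cell (CRIT-1's
`N11CU ⊕ Stub2WF` cut with `N11CU` absorbed).  CONDITIONAL on `h` (not supplied here); K1⁷ is NOT closed by this theorem; nothing of Bałaban asserted; no count moved.
[cite: Balaban1989LargeFieldII, Thm 1 p.355 + (0.1) pp.355–356 + p.391; Balaban1987RG1, Thm 2 p.259, Thm 3 p.264, (1.20)–(1.22) p.264, (2.12)–(2.14) p.268, (5.10) p.293; Balaban1988Convergent, Thm 1 p.262, (2.6) p.255 and Cor. 3 (2.50) p.264 (bookkeeping)] -/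
theorem stabilityBAtRecordR13SepCoPH_of_rung1WithChain_of_runRemAt
    (h : ∀ F : T4Family, (∃ θ : Stage13HParams F 2, θ.Provisos₁₃SepCoPH F 2 ∧ (θ.ZhUnity F 2 ∧ θ.SlotsNondegenerate₁₃ F 2) ∧ θ.Admissible F 2) →
      ∃ (θ : Stage13HParams F 2) (h : θ.Provisos₁₃SepCoPH F 2) (w : WorldP), Rung1At F θ h w ∧
        θ.ppSel = ppSelLiveOfRecord F 2 θ.ν θ.τ9 (EOfRecord₁₃ F 2 θ.toStage13Params) (wOfRecord₉ F 2 θ.toStage9Params) ∧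
        (0 ≤ θ.s2.lf.κ ∧ 0 ≤ θ.s2.lf.E₀ ∧ 0 ≤ θ.s2.lf.B₀ ∧ 1 ≤ θ.τ9.M) ∧
        (∀ P : B12.RunParams, ((datumOfRecord₁₃SepCoPH F 2 θ h).C P).flow.InInterval w.γ P.K → SupplyChainAt θ P) ∧
        ∃ (κ : StepColourData) (c A : ℝ), RunRemAt F κ θ h c ∧ OneLoopDrift (B12Normalization.stepBal 2 F.L) A (beta0OfJs F κ)) :
    Summit.QuantumFields.YangMills.Theses.BalabanUVNodes.StabilityBAtRecordR13SepCoPH := by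
  intro F hinh
  obtain ⟨θ, hP, w, hr, hsel, ⟨hκ, hE₀, hB₀, hM⟩, hN, κ, c, A, hRun, hdrift⟩ := h F hinh
  exact ⟨θ, hP, stabilityB_body_of_rung1At_of_runRemAt_of_drift_of_supplyChainAt θ hP w hr hsel hκ hE₀ hB₀ hM hN κ hRun hdrift⟩

end Registered

end Summit.QuantumFields.YangMills.Theorems.BalabanUVNodesN11K1CeilingFreeOfSupplyChain

end
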